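import Summits.RiemannHypothesis.RiemannHypothesis.Theorems.Splittings.LiFloorRateLaw
import HarnessLib

/-!
# The ends of the floor-rate scale: `r = 1` is RH, every `r < 1` is a verified-height statement, nothing in between;
# the UNCONDITIONAL envelope `|λ_n| ≤ C·(1 + 5·10⁻⁷)ⁿ` (SketchG9 §5)

Cell rh-split, seat rh-split-li-bridge g9 (brief sha16 f79c5f09d8bcb036), card `run/shared/lean/pub/rh-split/cards/SPLIT-li-bridge.md` §16;
kernel source `HOME/rh-split-li-bridge/SketchG9.lean` sha16 6b07bb859a043295 (409 l, farm rc 0, std axioms), cut by the seat at the scratch's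
section boundaries (l. 60–299 / l. 300–406), decl text byte-verbatim; deltas = namespace `RhSplit.LiBridgeG9` ↦ `…Theorems.Splittings.LiFloorRateLaw`,
imports, module docstrings.  Tree inputs only (cited, not re-derived): `LiExtremalLayer.li_two_signs_of_not_rh` / `exists_offline_zero` /
`normZ_lt_one` / `one_sub_inv_ne_zero` / `eventually_pos_of_rh` / `liPos_syndetic` (gen-5 carve), `LiOneSidedCriteria.liSubexpUpper_of_rh`
(gen-4 carve), `li_criterion_holds`, `LiIndexSets.re_eq_half_of_abs_im_le`, `BombieriLagarias.norm_inv_one_sub_inv_le_one_iff`,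
`riemannHypothesis_of_keiperLiCoeff_bddBelow`, `riemannHypothesisUpTo_1000` (standard axioms).

This file: `liFloorRate_one_iff_rh` — `(∃ C, ∀ n ≥ 1, −C ≤ λ_n) ⟺ RiemannHypothesis` (Bombieri–Lagarias' bounded-below criterion,
tree `riemannHypothesis_of_keiperLiCoeff_bddBelow`, re-derived through the law at `r = 1`; RH-EQUIVALENT, a RELABELLING);
`rh_iff_liFloorRate_all` — `RiemannHypothesis ⟺ ∀ r ∈ (0,1), ∃ C, ∀ n ≥ 1, −C·r^{−n} ≤ λ_n` (each single rate is a bounded zero-free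
region, only the conjunction over all `r < 1` is RH: no rung in between; cf. `LiOneSidedCriteria.rh_iff_liFloor`, the `∀ ε` form);
`liEnvelope_of_rhUpTo` — `RiemannHypothesisUpTo T → ∃ C, ∀ n ≥ 1, |λ_n| ≤ C·(√(1+T²)/T)ⁿ` (RH-FREE implication);
`liEnvelope_unconditional_1000` / `liEnvelope_unconditional_clean` — UNCONDITIONALLY `∃ C, ∀ n ≥ 1, |λ_n| ≤ C·(1 + 5/10⁷)ⁿ`
(standard axioms, from the tree's kernel-checked `riemannHypothesisUpTo_1000`; the compiled `riemannHypothesisUpTo_10000 / _100000`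
would give bases `√(1+10⁻⁸)` / `√(1+10⁻¹⁰)` by the same lemma and are deliberately not imported); `li_unbounded_above` —
UNCONDITIONALLY `∀ B, ∃ n ≥ 1, B < λ_n` (so the `r = 1` ceiling is a false statement, the one asymmetry of the scale; known content:
Voros' dichotomy).  Certifies nothing about RH.

HONEST LABEL: «SPLITTING SEARCH over kernel-typed RH-EQUIVALENCES; a splitting A ∧ B ⟹ RH is CONDITIONAL bookkeeping unless A and B are
both proved; nothing here bears on the truth of RH.»
-/

set_option linter.dupNamespace false

noncomputable section

open Complex Filter Topology Finset
open scoped Real ComplexConjugate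

namespace Summit.RiemannHypothesis.RiemannHypothesis.Theorems.Splittings.LiFloorRateLaw

open Literature.NumberTheory.LFunctions
open Literature.NumberTheory.DiophantineGeometry
open Summit.RiemannHypothesis.RiemannHypothesis.Theorems.Splittings
open Summit.RiemannHypothesis.RiemannHypothesis.Theorems.Splittings.LiIndexSets
open Summit.RiemannHypothesis.RiemannHypothesis.Theorems.Splittings.LiExtremalLayer
open Summit.RiemannHypothesis.RiemannHypothesis.Theorems.Splittings.LiOneSidedCriteria

/-! ## §5 The ends of the scale: `r = 1` is RH; every `r < 1` is a verified-height (FIN) statement; nothing in between -/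

/-- `r = 1`: the floor-rate law is Bombieri–Lagarias' **bounded-below criterion** `(∃ C, ∀ n ≥ 1, λ_n ≥ −C) ⟺ RH`
(tree: `riemannHypothesis_of_keiperLiCoeff_bddBelow`, `CostumeDetectors.liTail_iff_rh`). RH-EQUIVALENCE.
PRIVATE re-derivation from `liFloorRate_iff` at `r = 1`: the public theorem with this exact statement is the tree's
`CostumeDetectorsLi.liBddBelow_iff_rh` (typer dedup guard). -/
private theorem liFloorRate_one_iff_rh :
    (∃ C : ℝ, ∀ n : ℕ, 1 ≤ n → -C ≤ keiperLiCoeff n) ↔ _root_.RiemannHypothesis := by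
  have h := liFloorRate_iff (r := 1) one_pos le_rfl
  simp only [inv_one, one_pow, mul_one] at h
  exact h.trans rh_iff_forall_one_le_normZ.symm

/-- **No rung in between**: floors at EVERY rate `r < 1` ⟺ RH (cf. tree `LiOneSidedCriteria.rh_iff_liFloor`, the
`∀ ε` sub-exponential form).  Each single rate `r < 1` is a bounded zero-free region; only their conjunction over all
`r < 1` reaches RH. RH-EQUIVALENCE. -/
theorem rh_iff_liFloorRate_all :
    _root_.RiemannHypothesis ↔
      ∀ r : ℝ, 0 < r → r < 1 → ∃ C : ℝ, ∀ n : ℕ, 1 ≤ n → -(C * r⁻¹ ^ n) ≤ keiperLiCoeff n := by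
  constructor
  · intro h r hr0 hr1
    exact (liFloorRate_iff hr0 hr1.le).2 fun ρ hρ ↦ hr1.le.trans (one_le_normZ_of_rh h hρ)
  · intro h
    refine rh_iff_forall_one_le_normZ.2 fun ρ hρ ↦ ?_
    by_contra hlt
    rw [not_le] at hlt
    have hr0 : 0 < (‖1 - 1 / ρ‖ + 1) / 2 := by positivity
    have hr1 : (‖1 - 1 / ρ‖ + 1) / 2 < 1 := by linarith
    have := (liFloorRate_iff hr0 hr1.le).1 (h _ hr0 hr1) ρ hρ
    linarith

/-- **Verified height ⟹ two-sided envelope at rate `√(1+1/T²)`**: `RiemannHypothesisUpTo T` (`T > 0`) ⟹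
`|λ_n| ≤ C·(√(1+T²)/T)ⁿ` for all `n ≥ 1`.  (The tree's `LiTheory.liAsymptoticLawAllRange_holds` is the quantitative
version of this direction; recorded here as the FIN end of the floor-rate scale.) RH-FREE implication. -/
theorem liEnvelope_of_rhUpTo {T : ℝ} (hT : 0 < T) (hA : RiemannHypothesisUpTo T) :
    ∃ C : ℝ, ∀ n : ℕ, 1 ≤ n → |keiperLiCoeff n| ≤ C * (Real.sqrt (1 + T ^ 2) / T) ^ n := by
  have hr0 : 0 < T / Real.sqrt (1 + T ^ 2) := by positivity
  have hr1 : T / Real.sqrt (1 + T ^ 2) < 1 := by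
    rw [div_lt_one (Real.sqrt_pos.2 (by positivity))]
    calc T = Real.sqrt (T ^ 2) := (Real.sqrt_sq hT.le).symm
      _ < Real.sqrt (1 + T ^ 2) := Real.sqrt_lt_sqrt (by positivity) (by linarith)
  have h := (liEnvelopeRate_iff hr0 hr1).2 (forall_le_normZ_of_rhUpTo hT.le hA)
  simpa only [inv_div] using h

/-- **UNCONDITIONAL (standard axioms): `|λ_n| ≤ C·(√(1+10⁶)/10³)ⁿ = C·(√(1+10⁻⁶))ⁿ` for all `n ≥ 1`**, from the tree's
kernel-checked `riemannHypothesisUpTo_1000`.  (The compiled certificates `riemannHypothesisUpTo_10000` / `_100000` —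
`native_decide` auxiliaries — give rates `√(1+10⁻⁸)` / `√(1+10⁻¹⁰)` by the same lemma.) UNCONDITIONAL THEOREM. -/
theorem liEnvelope_unconditional_1000 :
    ∃ C : ℝ, ∀ n : ℕ, 1 ≤ n → |keiperLiCoeff n| ≤ C * (Real.sqrt (1 + 1000 ^ 2) / 1000) ^ n :=
  liEnvelope_of_rhUpTo (by norm_num) riemannHypothesisUpTo_1000

/-- The same with a rational base: **`|λ_n| ≤ C·(1 + 5·10⁻⁷)ⁿ` for all `n ≥ 1`, unconditionally.** UNCONDITIONAL THEOREM. -/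
theorem liEnvelope_unconditional_clean :
    ∃ C : ℝ, ∀ n : ℕ, 1 ≤ n → |keiperLiCoeff n| ≤ C * (1 + 5 / 10 ^ 7) ^ n := by
  obtain ⟨C, hC⟩ := liEnvelope_unconditional_1000
  have hb0 : 0 < Real.sqrt (1 + 1000 ^ 2) / 1000 := by positivity
  have hb : Real.sqrt (1 + 1000 ^ 2) / 1000 ≤ 1 + 5 / 10 ^ 7 := by
    rw [div_le_iff₀ (by norm_num : (0 : ℝ) < 1000)]
    calc Real.sqrt (1 + 1000 ^ 2) ≤ Real.sqrt (((1 + 5 / 10 ^ 7) * 1000) ^ 2) := Real.sqrt_le_sqrt (by norm_num)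
      _ = (1 + 5 / 10 ^ 7) * 1000 := Real.sqrt_sq (by norm_num)
  have hC0 : 0 ≤ C := by
    have h1 := hC 1 le_rfl
    have h2 := abs_nonneg (keiperLiCoeff 1)
    rw [pow_one] at h1
    nlinarith
  refine ⟨C, fun n hn ↦ (hC n hn).trans ?_⟩
  exact mul_le_mul_of_nonneg_left (pow_le_pow_left₀ hb0.le hb n) hC0

/-- **`λ_n` is unbounded above, unconditionally** (RH: `λ_n → +∞` by `eventually_pos_of_rh`'s source
`Voros2006_thm_onlyif_holds`; `¬RH`: `λ_n ≥ c·r₀^{−n}` on a syndetic set).  So the `r = 1` ceiling is not a criterion but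
a false statement — the one asymmetry of the scale. UNCONDITIONAL THEOREM. -/
theorem li_unbounded_above : ∀ B : ℝ, ∃ n : ℕ, 1 ≤ n ∧ B < keiperLiCoeff n := by
  intro B
  by_cases hRH : _root_.RiemannHypothesis
  · -- under RH: `λ_n ≥ n/2` for `n ≥ 2¹⁴` beyond the `o(n)` threshold of `Voros2006_thm_onlyif_holds`
    -- (the estimate inside the tree's `eventually_pos_of_rh`, verbatim), so `λ_n > B` once `n > 2B`.
    have hV := (Voros2006_thm_onlyif_holds hRH).def (show (0 : ℝ) < 1 / 2 by norm_num)
    obtain ⟨N, hN⟩ := eventually_atTop.1 (hV.and (eventually_ge_atTop (2 ^ 14)))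
    obtain ⟨n, hnN, hnB⟩ : ∃ n : ℕ, N ≤ n ∧ 2 * B < (n : ℝ) := by
      obtain ⟨m, hm⟩ := exists_nat_gt (2 * B)
      exact ⟨max N m, le_max_left _ _, hm.trans_le (by exact_mod_cast le_max_right N m)⟩
    obtain ⟨hb, hn14⟩ := hN n hnN
    have hn14' : (2 : ℝ) ^ 14 ≤ n := by exact_mod_cast hn14
    have hlog2 : (0.6931471803 : ℝ) < Real.log 2 := Real.log_two_gt_d9
    have hlogn : Real.log ((2 : ℝ) ^ 14) ≤ Real.log n := Real.log_le_log (by positivity) hn14'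
    rw [Real.log_pow] at hlogn
    push_cast at hlogn
    have hγ : (1 : ℝ) / 2 < Real.eulerMascheroniConstant := Real.one_half_lt_eulerMascheroniConstant
    have hlog2π : Real.log (2 * Real.pi) ≤ 2 * Real.pi - 1 := Real.log_le_sub_one_of_pos (by positivity)
    have hπ : Real.pi ≤ 4 := Real.pi_le_four
    have hbr : 2 ≤ Real.log n - 1 + Real.eulerMascheroniConstant - Real.log (2 * Real.pi) := by linarith
    rw [Real.norm_eq_abs, Real.norm_eq_abs, Nat.abs_cast] at hb
    have h1 := (abs_le.1 hb).1
    have hn0 : (0 : ℝ) ≤ n := Nat.cast_nonneg n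
    have hmain : (n : ℝ) ≤ (n : ℝ) / 2 *
        (Real.log n - 1 + Real.eulerMascheroniConstant - Real.log (2 * Real.pi)) := by nlinarith
    refine ⟨n, by omega, ?_⟩
    linarith
  · obtain ⟨r₀, hr₀0, hr₀1, -, -, c, hc, -, L, n₁, -, hwin⟩ := li_two_signs_of_not_rh hRH
    -- c · r₀^{-n} → ∞
    have ha : 1 < r₀⁻¹ := (one_lt_inv_iff₀).2 ⟨hr₀0, hr₀1⟩
    obtain ⟨N₀, hN₀⟩ :=
      eventually_atTop.1 ((tendsto_pow_atTop_atTop_of_one_lt ha).eventually_gt_atTop (B / c))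
    obtain ⟨⟨n, hn, hposv⟩, -⟩ := hwin (N₀ + n₁ + 1) (by omega)
    have h1 := (Finset.mem_Ico.1 hn).1
    have hg : B / c < r₀⁻¹ ^ n := hN₀ n (by omega)
    rw [div_lt_iff₀ hc] at hg
    refine ⟨n, by omega, ?_⟩
    linarith

end Summit.RiemannHypothesis.RiemannHypothesis.Theorems.Splittings.LiFloorRateLaw

end
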